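import Summits.Schanuel.Schanuel.Theorems.RootDecomp1KCubicDescent05

/-!
# RootDecomp1KOddEmpty — lens 1, generation 60, NODE 21 «ODD-PRIME EMPTINESS ON THE K-LINE» (reduction of the whole curve modulo an odd prime ℓ: no affine 𝔽_ℓ-point and no liftable point over Y = ∞ ⇒ no rational point with ℓ-integral abscissa ⇒ every level empty; RULE K-R51 (iii) payable clause; CLAIM L2795, PRICE L2798, K-R52) — part 1 (RootDecomp1KOddEmpty01): §0 helpers, §1 binary forms at a prime dividing den r, §2 the equation of a rational point in integers, §3 THE GENERAL ENGINE OddEmptyAt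

(lens-1 g60 NODE 21 HOME kernel K = HOME/decomp-schanuel-lens-1/g60/OddEmpty.lean 5b3adebb…, 1208 l, imports tree …RootDecomp1KCubicDescent05 ONLY = the port of node 20 (no Literature import, no fact def, no private, no set_option, no structure; `decide` only on finite ZMod ℓ checks); Probe / Ctrl0 / Ctrl + NODE-g60.md + SHA256SUMS; CLAIM L2795, census LIVENESS-v16 L2796 (key oddempty; of record L2798), crit g10 EX-ANTE PRICE L2798 (ONE THEOREM ×1 for (A) the general engine OddEmptyAt + (B) the W4-shape engine TangentEmptyAt + (C) the infinite K-R51-territory family V j JOINTLY iff CHECKLIST K-g60 (1)–(11); RULE K-R52 pre-announced), writer g31 NOTE 1 L2799 (pre-kernel arithmetic re-verified), NODE L2801 / REQUEST L2802, critic VERDICT L2804 (crit g10): CLEARED — THEOREM ×1 for (A) the general engine OddEmptyAt + (B) the W4-shape engine TangentEmptyAt + (C) the infinite K-R51-territory family V j JOINTLY under RULE K-R51 (iii), CHECKLIST K-g60 (1)–(11) met 11/11, rung 0; LABEL OF RECORD: literature = KNOWN TOOL (local insolubility at a finite place / reduction mod ℓ restricted to S-integral points, Hensel failure at a double point with anisotropic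 tangent cone) · relative to the record = NEW LEVER (first odd-place reading of the curve on the K-line) with NEW REACH (first K-R51-territory pairs — no ℚ-rational descent datum — decided hypothesis-free, at the currency LevelFinite / every level EMPTY); RULE K-R52 FIXED verbatim as pre-announced L2798 (toolkit ∪= LOCAL SIEVING IN GENERAL — every further OddEmptyAt / TangentEmptyAt member, ℓ, cone, jet, residue-class or Brauer–Manin-type variant ×0-as-record; OPEN TERRITORY at m₀ = 2 := K-R51 territory ∧ LOCALLY LIVE (census key locsol); standing witness W4 with its smooth ℤ[1/2]-point (0, −2)); TALLY lens-1 ×18 + THEOREM ×20; PORT GO exactly as census STAGING NOTES 11/11b L2800/L2803. Port by census-1 gen 23 as `RootDecomp1KOddEmpty01–05` (`--supports stmt-Schanuel-33364`; no census credit): 01 = §0 helpers, §1 the tree's binary forms `hf` at a prime dividing den r, §2 the equation of a rational point in integers for every `xPolyP k c` and the level abscissa (`not_dvd_den_level`), §3 THE GENERAL ENGINE `OddEmptyAt ℓ P` ⇒ `ratPoint_free_of_oddEmptyAt` / `no_level_of_oddEmptyAt` / `levelFinite_of_oddEmptyAt` / `bddLevelEmpty_of_oddEmptyAt` / `thinFibreAt_of_oddEmptyAt`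 (every m₀); 02 = §4 THE W4-SHAPE ENGINE (`descent_step`, `tangent_descent` — the v_ℓ-descent at the double point (0, ∞) with anisotropic tangent form —, `TangentEmptyAt ℓ P` ⇒ `no_level_of_tangentEmptyAt` / `levelFinite_…` / `bddLevelEmpty_…` / `thinFibreAt_of_tangentEmptyAt`) and §4b the REFUSALS (a rational ℓ-integral point / a root at x = 0 / degree conditions / ℓ = 2 kill the hypotheses); 03 = §5 section Families: `VW l` / `V j := VW (−3 + 15j)` with `tangentEmptyAt_five_V`, **`no_level_V`**, **`levelFinite_V`**, `bddLevelEmpty_V`, **`thinFibreAt_V (j m₀)`** HYPOTHESIS-FREE for every m₀, `EAW l` / `EA j` with `oddEmptyAt_three_EA`, `no_level_EA`, `levelFinite_EA`, `thinFibreAt_EA`, the REFUSED members `W4P` (rational point (0, −2)), `VW (−9)`, `R5P`, CJ 0 — typed non-instances; 04 = §6 section Disc: `xDisc (VW l) = vD l` primitive and ℚ-IRREDUCIBLE for l = 3s by a RABIN certificate mod 3 using the TREE's `dvd_X_pow_sub_X_zmod3` / `irreducible_of_coprime_zmod3` / `irreducible_of_irreducible_map3` (node 20); 05 = §7 section Territory: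 `V_territory (j)` (the K-R49 conjunction by tree names ∧ the K-R51 k = 2 certificate `Irreducible ((xDisc (V j)).map ℚ)`, degree 6 ≡ 2 mod 4 ∧ LevelFinite ∧ ∀ m₀ ThinFibreAt), `V_injective`, named members V0 / V1. PORT EDITS: NONE beyond the provenance doc blocks and the continuation headers (no docstring added — K documents every declaration —, no privatisation — the head dry-run showed no dedup code —, no re-pointing, no import change, no set_option; K's `@[simp]` kept); provenance doc blocks + continuation headers = K's own open-lines; statements and proofs VERBATIM. Rung 0 — nothing here proves Schanuel, 33364, 33363, 31077 or ThinFibre 2; everything HYPOTHESIS-FREE.)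
-/

/-
Copyright (c) 2026. All rights reserved.
Released under Apache 2.0 license as described in the file LICENSE.
-/

/-!
# RootDecomp1KOddEmpty — lens 1, generation 60, NODE 21 «ODD-PRIME EMPTINESS ON THE K-LINE»

THE LEVER (LEVEL-BLIND).  Read the WHOLE CURVE `P(x, Y) = Σ_{j ≤ k} x^j c_j(Y) = 0` modulo a prime `ℓ`, at the
rational points `(x, r)` whose abscissa is `ℓ`-INTEGRAL (`ℓ ∤ den x`):

* CHART 1 (`ℓ ∤ den r`): `(x, r)` reduces to an AFFINE `𝔽_ℓ`-point of `Σ_j x^j c̄_j(y) = 0`;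
* CHART 2 (`ℓ ∣ den r`, the points over `Y = ∞` with `x` finite): with `r = u/d`, `x = p/q` and the tree's binary
  forms `hf c n r = d^n c(u/d)` (`RootDecomp1KDescent.hf`, `RootDecomp1KLevelFinite.hform`), the equation in integers is
  `Σ_j p^j q^{k−j} hf(c_j) = 0` (§2), and modulo `ℓ` every `hf(c_j)` is `[Y^n]c_j · u^n`: the `Y`-TOP FORM
  `Σ_j [Y^n]c_j · x^j` acquires the root `x mod ℓ` (§3) — or, in the W4 SHAPE `k = 2`, `deg c₁ ≤ n − 1`,
  `deg c₀ ≤ n − 2` (`(0, ∞)` is a rational DOUBLE POINT of the projective closure; the top form is `lc(c₂)·x²`,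
  root `0`), the equation is `p²·H₂ + p·q·d·H₁ + q²·d²·H₀ = 0`, its reduction is `u^{n−2}·T(u·p, q·d)` with the
  TANGENT FORM `T(X, T) = [Y^n]c₂·X² + [Y^{n−1}]c₁·XT + [Y^{n−2}]c₀·T²`, and if `T` is ANISOTROPIC mod `ℓ` the equation
  DESCENDS (`ℓ^m ∣ p, d ⟹ ℓ^{m+1} ∣ p, d`), so `d = 0` — absurd (§4).

So: NO affine `𝔽_ℓ`-point ∧ (top form ROOTLESS mod `ℓ` ∨ W4 shape with ANISOTROPIC tangent form mod `ℓ`) ⟹ `P` HAS NO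
RATIONAL POINT WITH `ℓ`-INTEGRAL ABSCISSA (`ratPoint_free_of_oddEmptyAt`, `ratPoint_free_of_tangent` — the LEVEL-BLIND
CORE).  THE LEVEL STRUCTURE ENTERS ONLY THROUGH `den s_N ∣ 2^{N!}` (tree `partialSum_two_eq_ratCast`): for an ODD `ℓ`
every level abscissa is `ℓ`-integral, so EVERY LEVEL IS EMPTY — `∀ N r, P(s_N, r) ≠ 0` — hence `LevelFinite P`,
`BddLevelEmpty P` and `ThinFibreAt m₀ P` for EVERY `m₀` (including `0` and `1`), HYPOTHESIS-FREE: `LevelFinite` here is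
EMPTINESS, not finiteness-with-points.  Elementary (finite fields, one valuation, a descent on `v_ℓ`); NOT Chevalley–Weil,
not a degree ladder / Ridout engine / `LocalAt` (2-adic) / `GaussAt` (Gauss on the level polynomial reads denominators
only) / Thue–Mahler / Runge / height machine / descent / Subspace: no node of record reads `C(𝔽_ℓ)` for an odd `ℓ`.

CONTENTS.
* §0 helpers; §1 the tree's binary forms `hf` at a prime dividing the denominator (`cast_hf`, `dvd_hf_sub`,
  `cast_hf_of_dvd`, `hf_succ`);
* §2 THE POINT EQUATION IN INTEGERS for every `xPolyP k c` (`cast_pointSum`, `pointSum_eq_zero`) and the level abscissa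
  `s_N = p_N/2^{N!}`: `not_dvd_den_level` (no odd prime divides `den s_N`);
* §3 THE GENERAL ENGINE (every `x`-degree `k`): `affine_point_of_ratPoint` (chart 1), `topForm_root_of_ratPoint`
  (chart 2), class `OddEmptyAt ℓ P`, **`ratPoint_free_of_oddEmptyAt : OddEmptyAt ℓ P → ∀ x r : ℚ, ¬ ℓ ∣ x.den →
  bev P x r ≠ 0`** (level-blind core), **`no_level_of_oddEmptyAt : … → ∀ N r, bev P (partialSum 2 N) r ≠ 0`** (DERIVED),
  `levelFinite_of_oddEmptyAt`, `bddLevelEmpty_of_oddEmptyAt`, **`thinFibreAt_of_oddEmptyAt : … → ∀ m₀, ThinFibreAt m₀ P`**;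
* §4 THE W4-SHAPE ENGINE (`k = 2`): `descent_step` (anisotropic form ⇒ `ℓ ∣ a ∧ ℓ ∣ b`), `tangent_descent` (the
  `v_ℓ`-descent, pure `ℤ`-arithmetic), **`ratPoint_free_of_tangent`** (level-blind core), `no_level_of_tangent` (derived),
  class `TangentEmptyAt ℓ P`, `ratPoint_free_/no_level_/levelFinite_/bddLevelEmpty_/thinFibreAt_of_tangentEmptyAt`;
  §4b REFUSALS: a rational point with `ℓ`-integral abscissa, or a root of `c₀` mod `ℓ` (the affine point `(0, y)`), or
  `deg c₀ < deg c_i` (the top form has the root `0`) KILLS `OddEmptyAt ℓ` / `TangentEmptyAt ℓ`; `ℓ = 2` refused;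
* §5 THE FAMILIES: `VW l := (Y⁴ − 17)·x² + (Y³ + 1)·x + (2Y² + 7Y + l)` — W4's top AND W4's `x¹`-coefficient — with
  **`tangentEmptyAt_five_VW (t) : TangentEmptyAt 5 (VW (2 + 5t))`** (the reduction mod 5 typed: affine-pointless,
  tangent form `X² + XT + 2T²` anisotropic — `decide` on `ZMod 5`), `ratPoint_free_VW`, `no_level_VW`, `levelFinite_VW`,
  `thinFibreAt_VW : ∀ m₀, ThinFibreAt m₀ (VW (2 + 5t))`; the ℕ-family **`V j := VW (−3 + 15j)`** (CLAIM L2795)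
  with the same four theorems; the general-engine member `EAW l := (Y⁴−17)·x² + (Y³+1)·x + (Y⁴ + Y + l)`,
  `OddEmptyAt 3 (EAW (2 + 3t))`, `EA j := EAW (2 + 3j)` (no credit rests on `EA`); the standing witness **`W4P := (Y⁴−17)x² + (Y³+1)x + (Y+2)`
  REFUSED at EVERY `ℓ`** by its rational point `(0, −2)` (`not_oddEmptyAt_W4P`, `not_tangentEmptyAt_W4P`); instrument
  cells `¬ TangentEmptyAt 3 (V 0)`, `¬ OddEmptyAt ℓ (V j)` (all `ℓ`), `¬ OddEmptyAt 5 (EA 0)`, `¬ OddEmptyAt 3 (CJ 0)`; the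
  refusal witnesses `VW (−9)` (affine hypothesis load-bearing: point `(0, 1)`) and `R5P` (anisotropy load-bearing:
  affine-empty mod 5, isotropic tangent form, point `(5, 1/5)`); `not_tangentEmptyAt_EAW` (degree hypotheses
  load-bearing), `not_dvd_leadingCoeff_of_tangentEmptyAt` (`ℓ ∣ lc(c₂)` refused);
* §6 the `x`-DISCRIMINANT `Δ_x(VW l) = vD l` (sextic, lc `−7`), PRIMITIVE, and for `l = 3s` ℚ-IRREDUCIBLE by a RABIN
  certificate mod 3 REUSING node 20's tree lemmas (`three_eq_zero_zmod3X`, `irreducible_of_coprime_zmod3`,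
  `irreducible_of_irreducible_map3`) + Gauss: the K-R51 `k = 2` certificate «`Δ_x` ℚ-irreducible of degree
  `6 ≡ 2 (mod 4)`» TYPED uniformly in `j`;
* §7 TERRITORY of `V j` by tree names, exactly as node 20's `CJ_territory` (K-R49 conjunction: `x`-degree 2, `Y`-degree
  `4 = 2·xdeg`, top `Y⁴ − 17` ℚ-irreducible (Eisenstein at 17) of FULL degree with a `ℚ₂`-root (Hensel at 3) and no
  ℚ-root, separable, `eTop = 0`, rate 1 typed (Bezout, resultant `−4912`), `¬ DecidedAt 2`, `¬ LocalAt 2`,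
  `∀ m₀ ¬ GaussAt m₀`, `¬ XLinTM`, `¬ XLinearLt`, not x-linear / two-term / norm shape, `3 ≤ thinThreshold`, `SepTopAt 2`
  HONEST «node 11's conditional class — binder bypassed, not proved») ∧ the K-R51 certificate ∧ **`TangentEmptyAt 5 (V j)`,
  `∀ x r : ℚ, ¬ 5 ∣ x.den → bev (V j) x r ≠ 0`, `∀ N r, bev (V j) (partialSum 2 N) r ≠ 0`, `LevelFinite (V j)`,
  `BddLevelEmpty (V j)`, `∀ m₀, ThinFibreAt m₀ (V j)`**, `LevelSet (V j) C = ∅`; `V` injective (an INFINITE class); named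
  members `V 0`, `V 1`.

HONESTY.  RUNG 0: nothing here proves Schanuel, `FiniteOrderLiouvilleSchanuel` (33364), 33363, 31077, 31987 or the
uniform `ThinFibre 2`; `PadicSubspace` / `HeightComparison` are untouched.  `V j` has NO rational point with 5-integral
abscissa — a LOCAL reason; the level structure is used only through `den s_N = 2^{N!}`; every `LevelSet` of `V j` is
EMPTY, so `LevelFinite` here is emptiness, not finiteness-with-points.  The `V j` are territory members only because
K-R51 (ii) had no local-solubility clause (LIVENESS had no odd-place key before v16); no previously tabled member is
decided (LIVENESS-v16: oddempty NO ×47).  The standing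
witness W4 = `(Y⁴−17)x² + (Y³+1)x + (Y+2)` is NOT reached and CANNOT be reached by this lever or by any finite set of
local conditions: `(0, −2)` is a SMOOTH rational point with integral abscissa (`∂P/∂Y(0,−2) = 1`), so for every odd `ℓ`
and `k` the class `x ≡ 0 (mod ℓ^k)` lifts (Hensel) while `s_N` runs through every residue class mod `ℓ^k`
(`2^{n!} ≡ 1 (mod ℓ^k)` for `n ≥ n₀`, so `s_N ≡ c + (N − n₀)·1`) — typed here: `¬ OddEmptyAt ℓ W4P`, `¬ TangentEmptyAt ℓ W4P`
for every `ℓ ≠ 1`.  Literature status of the lever: KNOWN TOOL (local insolubility at a finite place for `S`-integral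
points; Hensel failure at a singular point with anisotropic tangent cone); problem-relative: a new CELL at a new PLACE.

Namespace `Summit.Schanuel.Schanuel.Theorems.RootDecomp1KOddEmpty`; imports the tree's port `…RootDecomp1KCubicDescent05`
ONLY (no Literature import, no fact def); no `private`, no `instance`, no `set_option`, no notation, no `sorry`, no
`native_decide` (`decide` only on closed finite goals over `ZMod 5` / `ZMod 3` — never on a `ℚ`/`ℤ`/`ℝ` statement); axioms standard.
-/

noncomputable section

namespace Summit.Schanuel.Schanuel.Theorems.RootDecomp1KOddEmpty

open Polynomial LiouvilleNumber
open scoped Nat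
open Summit.Schanuel.Schanuel.Theorems.RootDecomp1KTwoBaseCell (psNumer partialSum_eq_psNumer_div coprime_psNumer)
open Summit.Schanuel.Schanuel.Theorems.RootDecomp1KDegreeLadder
open Summit.Schanuel.Schanuel.Theorems.RootDecomp1KXLinear
open Summit.Schanuel.Schanuel.Theorems.RootDecomp1KXLinearII
open Summit.Schanuel.Schanuel.Theorems.RootDecomp1KXTop
open Summit.Schanuel.Schanuel.Theorems.RootDecomp1KXAll
open Summit.Schanuel.Schanuel.Theorems.RootDecomp1KLevelFinite
open Summit.Schanuel.Schanuel.Theorems.RootDecomp1KThueMahler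
open Summit.Schanuel.Schanuel.Theorems.RootDecomp1KParamThueMahler
open Summit.Schanuel.Schanuel.Theorems.RootDecomp1KLocalExponent
open Summit.Schanuel.Schanuel.Theorems.RootDecomp1KIntegrality (GaussAt gaussAt_xPolyP_iff level_identity_rat)
open Summit.Schanuel.Schanuel.Theorems.RootDecomp1KSubspaceBranch (SepTopAt)
open Summit.Schanuel.Schanuel.Theorems.RootDecomp1KHeightGrading (BddLevelEmpty bddLevelEmpty_iff_levelFinite)
open Summit.Schanuel.Schanuel.Theorems.RootDecomp1KRunge
open Summit.Schanuel.Schanuel.Theorems.RootDecomp1KDescent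
open Summit.Schanuel.Schanuel.Theorems.RootDecomp1KCubicDescent

/-! ### §0 Helpers -/

/-- a prime dividing the reduced denominator of `r` does not divide its numerator: `num r ≠ 0` in `𝔽_ℓ`. -/
theorem num_ne_zero_zmod_of_dvd_den {ℓ : ℕ} [Fact ℓ.Prime] (r : ℚ) (hden : ℓ ∣ r.den) :
    ((r.num : ℤ) : ZMod ℓ) ≠ 0 := by
  rw [Ne, ZMod.intCast_zmod_eq_zero_iff_dvd]
  intro hnum
  have h1 : ℓ ∣ r.num.natAbs := by simpa using Int.natAbs_dvd_natAbs.mpr hnum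
  exact (Fact.out : ℓ.Prime).one_lt.ne' (Nat.eq_one_of_dvd_coprimes r.reduced h1 hden)

/-- a natural number not divisible by `ℓ` is nonzero in `𝔽_ℓ`. -/
theorem natCast_ne_zero_zmod_of_not_dvd {ℓ n : ℕ} (h : ¬ ℓ ∣ n) : (n : ZMod ℓ) ≠ 0 := by
  rwa [Ne, ZMod.natCast_eq_zero_iff]

/-! ### §1 The tree's binary forms `hf c n r = den(r)^n · c(r)` at a prime dividing `den r` -/

/-- over ANY field in which `den r ≠ 0`: `hf f n r = den(r)^n · f(num r / den r)` (tree `hform_intCast`,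
`hform_eq_pow_mul_sum`, `sum_coeff_eq_aeval`; the tree's `hf_cast` is the case `ℚ`). -/
theorem cast_hf {K : Type*} [Field K] (f : ℤ[X]) {n : ℕ} (hfn : f.natDegree ≤ n) (r : ℚ) (hd : (r.den : K) ≠ 0) :
    ((hf f n r : ℤ) : K) = (r.den : K) ^ n * aeval ((r.num : K) / (r.den : K)) f := by
  rw [hf, hform_intCast, Int.cast_natCast, hform_eq_pow_mul_sum _ _ _ _ hd, sum_coeff_eq_aeval f hfn]

/-- all terms but the `Y^n`-one carry a factor `den r`: `den r ∣ hf f n r − f_n · (num r)^n`. -/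
theorem dvd_hf_sub (f : ℤ[X]) (n : ℕ) (r : ℚ) : (r.den : ℤ) ∣ hf f n r - f.coeff n * r.num ^ n := by
  rw [hf, hform, Finset.sum_range_succ, Nat.sub_self, pow_zero, mul_one, Int.cast_id, add_sub_cancel_right]
  refine Finset.dvd_sum fun i hi => ?_
  obtain ⟨m, rfl⟩ := Nat.exists_eq_add_of_lt (Finset.mem_range.mp hi)
  rw [show i + m + 1 - i = m + 1 by omega, pow_succ]
  exact Dvd.intro_left ((f.coeff i : ℤ) * r.num ^ i * (r.den : ℤ) ^ m) (by push_cast; ring)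

/-- in `𝔽_ℓ` with `ℓ ∣ den r`: `hf f n r ≡ f_n · (num r)^n`. -/
theorem cast_hf_of_dvd {ℓ : ℕ} (f : ℤ[X]) (n : ℕ) {r : ℚ} (hd : (ℓ : ℤ) ∣ (r.den : ℤ)) :
    ((hf f n r : ℤ) : ZMod ℓ) = ((f.coeff n : ℤ) : ZMod ℓ) * ((r.num : ℤ) : ZMod ℓ) ^ n := by
  have h := (ZMod.intCast_zmod_eq_zero_iff_dvd _ ℓ).mpr (hd.trans (dvd_hf_sub f n r))
  rwa [Int.cast_sub, Int.cast_mul, Int.cast_pow, sub_eq_zero] at h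

/-- lowering the padding degree: `hf f (n+1) r = den r · hf f n r` (`deg f ≤ n`). -/
theorem hf_succ (f : ℤ[X]) {n : ℕ} (hfn : f.natDegree ≤ n) (r : ℚ) : hf f (n + 1) r = (r.den : ℤ) * hf f n r := by
  rw [hf, hf, hform, hform, Finset.sum_range_succ _ (n + 1), coeff_eq_zero_of_natDegree_lt (Nat.lt_succ_of_le hfn),
    Int.cast_zero, zero_mul, zero_mul, add_zero, Finset.mul_sum]
  refine Finset.sum_congr rfl fun i hi => ?_
  have hi' : i ≤ n := Nat.lt_succ_iff.mp (Finset.mem_range.mp hi)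
  rw [show n + 1 - i = n - i + 1 by omega, pow_succ]
  ring

/-! ### §2 The equation of a rational point in integers, for every `xPolyP k c`; the level abscissa -/

/-- in a field where `den x` and `den r` are invertible the integer point sum DE-HOMOGENISES:
`Σ_j (num x)^j (den x)^{k−j} hf(c_j) = (den x)^k · (den r)^n · Σ_j (num x/den x)^j · c_j(num r/den r)`. -/
theorem cast_pointSum {K : Type*} [Field K] (k : ℕ) (c : ℕ → ℤ[X]) {n : ℕ}
    (hn : ∀ j, j ≤ k → (c j).natDegree ≤ n) (x r : ℚ) (hq : (x.den : K) ≠ 0) (hd : (r.den : K) ≠ 0) :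
    ((∑ j ∈ Finset.range (k + 1), x.num ^ j * (x.den : ℤ) ^ (k - j) * hf (c j) n r : ℤ) : K) =
      (x.den : K) ^ k * (r.den : K) ^ n *
        ∑ j ∈ Finset.range (k + 1), ((x.num : K) / (x.den : K)) ^ j * aeval ((r.num : K) / (r.den : K)) (c j) := by
  rw [Finset.mul_sum]
  push_cast
  refine Finset.sum_congr rfl fun j hj => ?_
  have hjk : j ≤ k := Nat.lt_succ_iff.mp (Finset.mem_range.mp hj)
  rw [cast_hf (c j) (hn j hjk) r hd]
  obtain ⟨m, rfl⟩ := Nat.exists_eq_add_of_le hjk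
  rw [Nat.add_sub_cancel_left, pow_add, div_pow]
  field_simp

/-- **THE POINT EQUATION IN INTEGERS**: at a rational point `(x, r)` of `xPolyP k c`,
`Σ_{j ≤ k} (num x)^j · (den x)^{k−j} · hf (c j) n r = 0` (this is `(den x)^k · (den r)^n · P(x, r)`; `n ≥ deg c_j`). -/
theorem pointSum_eq_zero (k : ℕ) (c : ℕ → ℤ[X]) {n : ℕ} (hn : ∀ j, j ≤ k → (c j).natDegree ≤ n) {x r : ℚ}
    (hP : bev (xPolyP k c) x r = 0) :
    ∑ j ∈ Finset.range (k + 1), x.num ^ j * (x.den : ℤ) ^ (k - j) * hf (c j) n r = 0 := by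
  have hq : (x.den : ℝ) ≠ 0 := by exact_mod_cast x.den_nz
  have hd : (r.den : ℝ) ≠ 0 := by exact_mod_cast r.den_nz
  have key := cast_pointSum (K := ℝ) k c hn x r hq hd
  have hsum : ∑ j ∈ Finset.range (k + 1), ((x.num : ℝ) / (x.den : ℝ)) ^ j *
      aeval ((r.num : ℝ) / (r.den : ℝ)) (c j) = 0 := by
    rw [bev_xPolyP, Rat.cast_def, Rat.cast_def] at hP
    exact hP
  rw [hsum, mul_zero] at key
  exact_mod_cast key

/-- THE LEVEL ABSCISSA `s_N = p_N / 2^{N!}` AS A RATIONAL (tree `partialSum_two_eq_ratCast`) HAS A POWER-OF-2 DENOMINATOR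
(Mathlib `Rat.den_dvd`): NO ODD PRIME DIVIDES `den s_N` — the ONLY place where the level structure enters this node. -/
theorem not_dvd_den_level {ℓ : ℕ} (hprime : ℓ.Prime) (hℓ : ℓ ≠ 2) (N : ℕ) :
    ¬ ℓ ∣ ((psNumer 2 N : ℚ) / 2 ^ N !).den := by
  intro h
  have h1 : ((((psNumer 2 N : ℚ) / 2 ^ N !).den : ℤ)) ∣ (2 : ℤ) ^ N ! := by
    have := Rat.den_dvd ((psNumer 2 N : ℕ) : ℤ) ((2 : ℤ) ^ N !)
    rw [Rat.divInt_eq_div] at this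
    push_cast at this
    exact this
  have h2 : (ℓ : ℤ) ∣ (2 : ℤ) ^ N ! := (Int.natCast_dvd_natCast.mpr h).trans h1
  have h3 : ℓ ∣ 2 ^ N ! := by exact_mod_cast h2
  exact hℓ ((Nat.prime_dvd_prime_iff_eq hprime Nat.prime_two).mp (hprime.dvd_of_dvd_pow h3))

/-! ### §3 THE GENERAL ENGINE: no affine `𝔽_ℓ`-point and a rootless top form ⟹ NO `ℓ`-INTEGRAL RATIONAL POINT -/

/-- CHART 1 (`ℓ ∤ den x`, `ℓ ∤ den r`): the rational point `(x, r)` reduces to an AFFINE `𝔽_ℓ`-POINT of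
`Σ_j a^j c_j(y) = 0` (`a = x mod ℓ`, `y = r mod ℓ`). -/
theorem affine_point_of_ratPoint (k : ℕ) (c : ℕ → ℤ[X]) {n : ℕ} (hn : ∀ j, j ≤ k → (c j).natDegree ≤ n)
    {ℓ : ℕ} [Fact ℓ.Prime] {x r : ℚ} (hP : bev (xPolyP k c) x r = 0) (hx : ¬ ℓ ∣ x.den) (hden : ¬ ℓ ∣ r.den) :
    ∃ a y : ZMod ℓ, ∑ j ∈ Finset.range (k + 1), a ^ j * aeval y (c j) = 0 := by
  have hq : (x.den : ZMod ℓ) ≠ 0 := natCast_ne_zero_zmod_of_not_dvd hx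
  have hd : (r.den : ZMod ℓ) ≠ 0 := natCast_ne_zero_zmod_of_not_dvd hden
  have key := cast_pointSum (K := ZMod ℓ) k c hn x r hq hd
  rw [pointSum_eq_zero k c hn hP, Int.cast_zero] at key
  exact ⟨_, _, (mul_eq_zero.mp key.symm).resolve_left (mul_ne_zero (pow_ne_zero _ hq) (pow_ne_zero _ hd))⟩

/-- CHART 2 (`ℓ ∤ den x`, `ℓ ∣ den r`): the rational point `(x, r)` reduces to a ROOT `a = x mod ℓ` of the `Y`-TOP FORM
`Σ_j [Y^n]c_j · a^j` (the points of the projective closure over `Y = ∞` with `x` finite). -/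
theorem topForm_root_of_ratPoint (k : ℕ) (c : ℕ → ℤ[X]) {n : ℕ} (hn : ∀ j, j ≤ k → (c j).natDegree ≤ n)
    {ℓ : ℕ} [Fact ℓ.Prime] {x r : ℚ} (hP : bev (xPolyP k c) x r = 0) (hx : ¬ ℓ ∣ x.den) (hden : ℓ ∣ r.den) :
    ∃ a : ZMod ℓ, ∑ j ∈ Finset.range (k + 1), a ^ j * (((c j).coeff n : ℤ) : ZMod ℓ) = 0 := by
  have hq : (x.den : ZMod ℓ) ≠ 0 := natCast_ne_zero_zmod_of_not_dvd hx
  have hu := num_ne_zero_zmod_of_dvd_den r hden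
  have hdZ : (ℓ : ℤ) ∣ (r.den : ℤ) := Int.natCast_dvd_natCast.mpr hden
  have h := congrArg (Int.cast : ℤ → ZMod ℓ) (pointSum_eq_zero k c hn hP)
  simp only [Int.cast_sum, Int.cast_mul, Int.cast_pow, Int.cast_zero, Int.cast_natCast, cast_hf_of_dvd _ n hdZ] at h
  refine ⟨((x.num : ℤ) : ZMod ℓ) / (x.den : ZMod ℓ), ?_⟩
  have key : ∑ j ∈ Finset.range (k + 1), ((x.num : ℤ) : ZMod ℓ) ^ j * (x.den : ZMod ℓ) ^ (k - j) *
      ((((c j).coeff n : ℤ) : ZMod ℓ) * ((r.num : ℤ) : ZMod ℓ) ^ n) =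
      (x.den : ZMod ℓ) ^ k * ((r.num : ℤ) : ZMod ℓ) ^ n *
        ∑ j ∈ Finset.range (k + 1), (((x.num : ℤ) : ZMod ℓ) / (x.den : ZMod ℓ)) ^ j *
          (((c j).coeff n : ℤ) : ZMod ℓ) := by
    rw [Finset.mul_sum]
    refine Finset.sum_congr rfl fun j hj => ?_
    obtain ⟨m, rfl⟩ := Nat.exists_eq_add_of_le (Nat.lt_succ_iff.mp (Finset.mem_range.mp hj))
    rw [Nat.add_sub_cancel_left, pow_add, div_pow]
    field_simp
  rw [key] at h
  exact (mul_eq_zero.mp h).resolve_left (mul_ne_zero (pow_ne_zero _ hq) (pow_ne_zero _ hu))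

/-- [class] definition (census convention): **ODD-PRIME EMPTINESS `OddEmptyAt ℓ P`** — a presentation
`P = Σ_{j ≤ k} x^j c_j(Y)` with a padding degree `n ≥ deg c_j`, a prime `ℓ ≠ 2`, NO affine `𝔽_ℓ`-point of
`Σ_j x^j c_j(y)`, and the `Y^n`-form `Σ_j [Y^n]c_j · x^j` ROOTLESS mod `ℓ` (no `𝔽_ℓ`-point over `Y = ∞` with `x` finite). -/
def OddEmptyAt (ℓ : ℕ) (P : ℤ[X][X]) : Prop :=
  ∃ (k : ℕ) (c : ℕ → ℤ[X]) (n : ℕ), P = xPolyP k c ∧ (∀ j, j ≤ k → (c j).natDegree ≤ n) ∧ ℓ.Prime ∧ ℓ ≠ 2 ∧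
    (∀ x y : ZMod ℓ, ∑ j ∈ Finset.range (k + 1), x ^ j * aeval y (c j) ≠ 0) ∧
    (∀ x : ZMod ℓ, ∑ j ∈ Finset.range (k + 1), x ^ j * (((c j).coeff n : ℤ) : ZMod ℓ) ≠ 0)

/-- **THE GENERAL ENGINE, LEVEL-BLIND CORE: an `OddEmptyAt ℓ` pair has NO RATIONAL POINT WITH `ℓ`-INTEGRAL ABSCISSA.** -/
theorem ratPoint_free_of_oddEmptyAt {ℓ : ℕ} {P : ℤ[X][X]} (h : OddEmptyAt ℓ P) (x r : ℚ) (hx : ¬ ℓ ∣ x.den) :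
    bev P x r ≠ 0 := by
  obtain ⟨k, c, n, rfl, hn, hprime, -, haff, htop⟩ := h
  haveI : Fact ℓ.Prime := ⟨hprime⟩
  intro hP
  by_cases hden : ℓ ∣ r.den
  · obtain ⟨a, ha⟩ := topForm_root_of_ratPoint k c hn hP hx hden
    exact htop a ha
  · obtain ⟨a, y, hay⟩ := affine_point_of_ratPoint k c hn hP hx hden
    exact haff a y hay

/-- **… hence NO LEVEL POINT AT ALL** (DERIVED: `den s_N` is a power of `2`, `ℓ` is odd — `not_dvd_den_level`). -/
theorem no_level_of_oddEmptyAt {ℓ : ℕ} {P : ℤ[X][X]} (h : OddEmptyAt ℓ P) (N : ℕ) (r : ℚ) :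
    bev P (partialSum 2 N) r ≠ 0 := by
  have ⟨_, _, _, _, _, hprime, hℓ, _⟩ := h
  rw [partialSum_two_eq_ratCast]
  exact ratPoint_free_of_oddEmptyAt h _ r (not_dvd_den_level hprime hℓ N)

/-- no level point at all ⟹ every level set is EMPTY ⟹ `LevelFinite`. -/
theorem levelFinite_of_no_level {P : ℤ[X][X]} (h : ∀ (N : ℕ) (r : ℚ), bev P (partialSum 2 N) r ≠ 0) :
    LevelFinite P := by
  intro C
  refine Set.finite_empty.subset ?_
  rintro N ⟨r, -, hP, -⟩
  exact h N r hP

/-- `OddEmptyAt ℓ P → LevelFinite P` (every level set EMPTY). -/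
theorem levelFinite_of_oddEmptyAt {ℓ : ℕ} {P : ℤ[X][X]} (h : OddEmptyAt ℓ P) : LevelFinite P :=
  levelFinite_of_no_level (no_level_of_oddEmptyAt h)

/-- `OddEmptyAt ℓ P → BddLevelEmpty P` (the B-side currency, tree `bddLevelEmpty_iff_levelFinite`). -/
theorem bddLevelEmpty_of_oddEmptyAt {ℓ : ℕ} {P : ℤ[X][X]} (h : OddEmptyAt ℓ P) : BddLevelEmpty P :=
  (bddLevelEmpty_iff_levelFinite P).mpr (levelFinite_of_oddEmptyAt h)

/-- **`OddEmptyAt ℓ P → ThinFibreAt m₀ P` at EVERY quality `m₀`** (incl. `0`, `1`), hypothesis-free. -/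
theorem thinFibreAt_of_oddEmptyAt {ℓ : ℕ} {P : ℤ[X][X]} (h : OddEmptyAt ℓ P) (m₀ : ℕ) : ThinFibreAt m₀ P :=
  thinFibreAt_of_levelFinite (levelFinite_of_oddEmptyAt h) m₀

end Summit.Schanuel.Schanuel.Theorems.RootDecomp1KOddEmpty

end
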